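import Summits.QuantumFields.YangMills.Theorems.UnitScaleTiltProp7AxialReprPrint
import Summits.QuantumFields.YangMills.Theorems.UnitScaleTiltProp7AxialGauge
import Summits.QuantumFields.YangMills.Theorems.UnitScaleTiltProp7AxialSpace18Print
import Summits.QuantumFields.YangMills.Theorems.UnitScaleTiltProp7Orbit16UnsatZd
import Literature.MathematicalPhysics.QuantumFieldTheory.Balaban1983to89.B7Eq167Flat
import HarnessLib

/-!
# Route `UnitScaleTilt`, crux K1 child «MinimiserStabilityRegPr» (stmt-QuantumFields-19200), registered stub `stub_prop7From14` (skeleton birth_v7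
# cc37a178…; leaf V3) — THE LQB LAW `Orbit16` OF THE KNIT IS REFUTED FOR PRINT'S PRESENTATION: for every presentation `S` whose `Restricted` is
# implied by [Balaban1985RegularSpaces] (1.29) (= [Balaban1985Averaging] (78)–(81), based at the `k`-centre), `¬ T3SectALandauChart.Orbit16 S`

Cell `ym3-torus` ∕ fleet seat `ym-ust-19200-p1` (gen 8; HUMAN RULING D-0037, YM ladder rung R3).  WHY.  The knit `T3SectALandauChart.prop7From14At_of_
props_of_located` (the owner's planned v8 re-cut of V3) presents two Sect. A laws; gen 8 located that the second, `Orbit16` (LQB `B11Prop7Assembly.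
Bridge.Laws.orbit16`: «for EVERY U₁ and ANY two restricted u, u′ the images (U₁U₀)^u, (U₁U₀)^{u′} lie on one orbit of the group (4)»), is NOT print's
p. 281 «one-to-one» and re-assembled the knit with print's law (`Prop7ChartInjectivity`, p567142; both print laws proved in `Prop7AxialReprPrint`).
THIS FILE makes the location a KERNEL FACT: `Orbit16` FAILS for print's letters.  WITNESS at the trivial background and perturbation `U₀ = U₁ = 1`:
`u′ = 1` and the two-point bump `u = e^{X}` at the `k`-centre `x₀`, `e^{−X}` at `x₀ + e_0`, `1` elsewhere, `X = ⅛·diag(i, −i) ∈ 𝔰𝔲(2)`.  Both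
satisfy (1.29): the block average (78) over the block at `x₀` has exponents `log(u(x₀)⁻¹u(x))` equal to `0`, `−2X`, and `−X` (`Lᵈ − 2` times), which
sum to `−LᵈX`, so `{u}_{B(x₀)} = e^{X}e^{−X} = 1`, every other block sees `u ≡ 1`, and the higher averages (79)–(80) of the constant `1` are `1`
([Balaban1985RegularSpaces] p. 80: the conditions (1.29) «do not agree with the group structure» — restricted `u` need not be `1` at the centres).  But
`(1)^{u} = 1^u` and `(1)^{u′} = 1` lie on one (4)-orbit only if `wu` is CONSTANT for some `w` trivial at the `k`-centres (a pure gauge is trivial only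
for a constant transformation, `eq_of_gaugeAct_one`); comparing the centres `x₀` and `x₀ + Lᵏe_0` gives `e^{X} = 1`, `X = log e^{X} = 0` — absurd.

WHAT IS PROVED (sorry-free, no definition; the element and the `ℤᵈ` averages of the bump are the companion `UnitScaleTiltProp7Orbit16UnsatZd`).
§1 torus: `eq_of_gaugeAct_one` (`1^w = 1 ⟹ w` constant, via the transport (8) along the comb), `transl_eq_transl_iff`.
§2 T³: **`not_orbit16_print`** — for every `S : T3SectALandauChart.Resid F n K` (`n < K`) whose `Restricted U₀ u` is implied by the based
   (1.29)-reading, `¬ Orbit16 F n K _ S`.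

CONSEQUENCE (count-neutral, for the v8 pen).  `T3SectALandauChart.prop7From14At_of_props_of_located` is NOT instantiable at print's presentation
(its hypothesis `h16` is false there); use `Prop7ChartPrint.prop7From14At_of_props_print` ∕ `Prop7PillarsPrint.prop7From14At_of_pillars_print`
(print's laws, both theorems).  HONEST SCOPE: a statement about the LQB reading of one sentence, not about [Balaban1985Variational]; nothing of the
paper's analysis is claimed; helper toward stmt-QuantumFields-19200 (`--supports`), not a proof or refutation of the stub.

References: T. Bałaban, CMP 99 (1985) 75–102 [Balaban1985RegularSpaces] ((1.14) p.78, (1.29) p.81, p.80); CMP 102 (1985) 277–309 [Balaban1985Variational]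
((4) p.278, (16)–(18) p.280, Prop. 2 p.281); CMP 98 (1985) 17–51 [Balaban1985Averaging] ((8) p.18, (78)–(81) p.30).
-/

noncomputable section

namespace Summit.QuantumFields.YangMills.Theorems.Prop7Orbit16Unsat

open Literature.MathematicalPhysics.QuantumFieldTheory.Balaban1983to89
open B7Prop1Explicit renaming Site → LSite
open B7Prop1Explicit (e e_apply boxVec expUnit val_expUnit val_inv_expUnit disp_treeWord treeWord)
open B10Eq27TorusAxialLog (transl transl_apply transl_zero transl_add_e transl_rel rel holT holT_one gaugeActT gaugeActT_eq_gaugeAct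
  transl_disp_treeWord_rel pull pull_apply unitsField toUField suIncl val_suIncl)
open B8Thm2SetupTorus (pullGauge pullGauge_apply toUGauge)
open Summit.QuantumFields.YangMills.Theorems.Prop7AxialGauge (holT_gaugeActT)

open Summit.QuantumFields.YangMills.Theorems.Prop7Orbit16UnsatZd

/-! ## §1 Two pieces of torus bookkeeping -/

section TorusLemmas

variable {P : Params} {j : ℕ}

/-- **A PURE GAUGE IS TRIVIAL ONLY FOR A CONSTANT GAUGE TRANSFORMATION** (torus): if `1^w = 1` then `w` is constant — the transport of `1^w = 1`
along the comb `Γ_{x,y}` is `w(x)·1·w(y)⁻¹` ([Balaban1985Averaging] (8)). [cite: Balaban1985Averaging, (8) p.18] -/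
theorem eq_of_gaugeAct_one {G : Type*} [GaugeGroup G] {w : GaugeTransf P j G}
    (h : GaugeField.gaugeAct w (fun _ : PBond P j => (1 : G)) = fun _ => 1) (x y : Site P j) : w y = w x := by
  have ht := holT_gaugeActT w (fun _ : PBond P j => (1 : G)) x (treeWord (rel x y))
  rw [gaugeActT_eq_gaugeAct, h, holT_one, mul_one, transl_disp_treeWord_rel] at ht
  -- `ht : 1 = w x * (w y)⁻¹`
  have := congrArg (fun g => g * w y) ht
  simp only [one_mul, inv_mul_cancel_right] at this
  exact this

/-- Translates of one site by two integer vectors coincide iff the vectors are congruent modulo the period. [cite: Balaban1987RG1, (0.1) p.251] -/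
theorem transl_eq_transl_iff (x₀ : Site P j) (z z' : LSite P.d) :
    transl x₀ z = transl x₀ z' ↔ ∀ i : Fin P.d, ((P.sitesPerDir j : ℕ) : ℤ) ∣ z' i - z i := by
  constructor
  · intro h i
    have hi := congrFun h i
    rw [transl_apply, transl_apply, add_right_inj] at hi
    exact (ZMod.intCast_eq_intCast_iff_dvd_sub _ _ _).1 hi
  · intro h
    funext i
    rw [transl_apply, transl_apply, add_right_inj]
    exact (ZMod.intCast_eq_intCast_iff_dvd_sub _ _ _).2 (h i)

end TorusLemmas

/-! ## §2 At the T³ carrier: the law `Orbit16` FAILS for every presentation whose `Restricted` is implied by print's (based) (1.29) -/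

section T3

open scoped Matrix.Norms.L2Operator
open NormedSpace
open Literature.MathematicalPhysics.QuantumFieldTheory.Balaban1983to89.T3ContinuumYM3Torus
open Literature.MathematicalPhysics.QuantumFieldTheory.Balaban1983to89.T3PrintedRegularMinimiser (unitsField_toUField_one)
open Literature.MathematicalPhysics.QuantumFieldTheory.Balaban1983to89.T3PrintedRegularOrbits (descTransf)
open Literature.MathematicalPhysics.QuantumFieldTheory.Balaban1983to89.T3UnitLawGaugeInvariance (gaugeAct_gaugeAct)
open B8Eq119TwistedAxial (Restr129)
open B8Eq178Averages (restr129_iff_uavg)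
open B8Thm4TorusAt (torusLam mem_torusLam_iff)
open B15DeterminingSets (embIter)
open B7Eq84Concrete (uavg)
open B7Eq78Linearization (Rbar_one)
open MatrixLog (mlog mlog_one)
open T3SectALandauChart (Resid Orbit16 emb15 emb15_one)
open Summit.QuantumFields.YangMills.Theorems.Prop7FlatHolonomy (sitesPerDir_zero_eq_mul_pow)
open Summit.QuantumFields.YangMills.Theorems.Prop7AxialSpace18Print (apply_embIter_eq_one_of_descTransf transl_embIter_zero_smul)

variable (F : T3Family) {n K : ℕ} (hnK : n < K)

/-- **THE LQB LAW `Orbit16` IS UNSATISFIABLE BY PRINT'S PRESENTATION** — for every presentation `S` of the residual layer whose `Restricted U₀ u` is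
IMPLIED by [Balaban1985RegularSpaces] (1.29) (the `k`-th order averages (79)–(81) of [Balaban1985Averaging] of `u` relative to `U₀` are `1` on the top
lattice, read on the pullback based at the `k`-centre `x₀ = embIter k 0`), `¬ T3SectALandauChart.Orbit16 S`.  WITNESS: `U₀ = U₁ = 1`, `u′ = 1` and the
two-point bump `u = e^{X}` at `x₀`, `e^{−X}` at `x₀ + e_0`, `1` elsewhere, `X = ⅛·diag(i, −i)`: both are restricted (`savg_bump_eq_one`: every block
average of `u` is `1`), but `(1)^{u} = 1^u` and `1` lie on one (4)-orbit only if `wu` is constant for some `w` trivial at the centres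
(`eq_of_gaugeAct_one`) — comparing the centres `x₀` and `x₀ + Lᵏe_0` gives `e^{X} = 1`, `X = 0`.  So the law `orbit16` of `B11Prop7Assembly.Bridge.Laws`
read at the T³ objects (`T3SectALandauChart.Orbit16`) cannot be discharged for print's letters; the corrected knit (`Prop7ChartInjectivity`) uses print's
injectivity instead. [cite: Balaban1985RegularSpaces, (1.29) p.81, p.80 («they do not agree with the group structure»); Balaban1985Variational, Prop. 2 p.281; Balaban1985Averaging, (78)–(81) p.30] -/
theorem not_orbit16_print (S : Resid F n K)
    (hSre : ∀ (U₀ : GaugeField (F.P K) 0 (Matrix.specialUnitaryGroup (Fin 2) ℂ)) (u : GaugeTransf (F.P K) 0 (Matrix.specialUnitaryGroup (Fin 2) ℂ)),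
      Restr129 (F.P K).L (K - n) (torusLam (K - n)) (pull (unitsField (toUField U₀)) (embIter (K - n) (0 : Site (F.P K) (K - n))))
        (pullGauge (fun x => Unitary.toUnits (toUGauge (F.P K) 2 u x)) (embIter (K - n) (0 : Site (F.P K) (K - n)))) → S.Restricted U₀ u) :
    ¬ Orbit16 F n K hnK.le S := by
  letI : NormedAlgebra ℚ (Matrix (Fin 2) (Fin 2) ℂ) := NormedAlgebra.restrictScalars ℚ ℂ _
  intro H
  -- abbreviations
  set P : Params := F.P K with hP
  set k : ℕ := K - n with hk
  have hk1 : 1 ≤ k := by omega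
  have hkm : k ≤ P.m + P.K := by show K - n ≤ F.m + K; omega
  have hL2 : 2 ≤ P.L := P.hL.2
  set x₀ : Site P 0 := embIter k (0 : Site P k) with hx₀
  set i₀ : Fin P.d := ⟨0, P.hd⟩ with hi₀
  set N : ℤ := ((P.sitesPerDir 0 : ℕ) : ℤ) with hN
  have hN0 : P.sitesPerDir 0 = P.sitesPerDir k * P.L ^ k := sitesPerDir_zero_eq_mul_pow hkm
  have hNk1 : 1 ≤ P.sitesPerDir k := Nat.one_le_iff_ne_zero.mpr (P.sitesPerDir_ne_zero k)
  have hLk : (P.L : ℤ) ≤ (P.L : ℤ) ^ k := by exact_mod_cast le_self_pow₀ (by omega : 1 ≤ P.L) (by omega : k ≠ 0)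
  have hLN : (P.L : ℤ) ∣ N := by
    refine ⟨(P.sitesPerDir k : ℤ) * (P.L : ℤ) ^ (k - 1), ?_⟩
    rw [hN, hN0]; push_cast
    rw [show (P.L : ℤ) ^ k = P.L * (P.L : ℤ) ^ (k - 1) by rw [← pow_succ']; congr 1; omega]
    ring
  have hLN' : (P.L : ℤ) ≤ N := by
    rw [hN, hN0]; push_cast
    calc (P.L : ℤ) ≤ (P.L : ℤ) ^ k := hLk
      _ = 1 * (P.L : ℤ) ^ k := (one_mul _).symm
      _ ≤ (P.sitesPerDir k : ℤ) * (P.L : ℤ) ^ k := by gcongr; exact_mod_cast hNk1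
  -- the element
  set Sm : Matrix (Fin 2) (Fin 2) ℂ := !![Complex.I, 0; 0, -Complex.I] with hSm
  set X : Matrix (Fin 2) (Fin 2) ℂ := (((1 : ℝ) / 8 : ℝ) : ℂ) • Sm with hX
  have hXn : ‖X‖ ≤ 1 / 8 := by rw [hX, hSm, norm_smul_S]; norm_num
  have hgmem : exp X ∈ Matrix.specialUnitaryGroup (Fin 2) ℂ := B10Eq32AxialSuN.exp_smul_mem_specialUnitaryGroup 2 star_S trace_S _
  set g : Matrix.specialUnitaryGroup (Fin 2) ℂ := ⟨exp X, hgmem⟩ with hg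
  have hgU : Unitary.toUnits (suIncl g) = expUnit X := Units.ext rfl
  -- the bump and its based pullback
  set u : GaugeTransf P 0 (Matrix.specialUnitaryGroup (Fin 2) ℂ) :=
    fun x => if x = x₀ then g else if x = x₀.shift i₀ then g⁻¹ else 1 with hu
  have hsh : x₀.shift i₀ = transl x₀ (e i₀) := by
    have := transl_add_e x₀ 0 i₀
    rw [zero_add, transl_zero] at this
    exact this.symm
  have hN2 : (2 : ℤ) ≤ N := le_trans (by exact_mod_cast hL2) hLN'
  have hx₀ne : x₀.shift i₀ ≠ x₀ := by
    intro h
    rw [hsh] at h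
    have h' := (transl_eq_transl_iff x₀ (e i₀) 0).1 (by rw [transl_zero]; exact h) i₀
    rw [e_apply, if_pos rfl, Pi.zero_apply, zero_sub, dvd_neg] at h'
    have := Int.le_of_dvd one_pos h'
    linarith
  -- the based pullback of the bump: `e^{X}` on `Nℤᵈ`, `e^{−X}` on `e_{i₀} + Nℤᵈ`, `1` elsewhere
  set w : LSite P.d → (Matrix (Fin 2) (Fin 2) ℂ)ˣ := pullGauge (fun x => Unitary.toUnits (toUGauge P 2 u x)) x₀ with hw
  have htr0 : ∀ x : LSite P.d, (∀ i, N ∣ x i) ↔ transl x₀ x = x₀ := by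
    intro x
    constructor
    · intro hx
      have h2 := (transl_eq_transl_iff x₀ x 0).2 (fun i => by rw [Pi.zero_apply, zero_sub, dvd_neg]; exact hx i)
      rwa [transl_zero] at h2
    · intro h i
      have h2 := (transl_eq_transl_iff x₀ x 0).1 (by rw [transl_zero]; exact h) i
      rwa [Pi.zero_apply, zero_sub, dvd_neg] at h2
  have htr1 : ∀ x : LSite P.d, (∀ i, N ∣ x i - e i₀ i) ↔ transl x₀ x = x₀.shift i₀ := by
    intro x
    rw [hsh]
    constructor
    · intro hx
      exact (transl_eq_transl_iff x₀ x (e i₀)).2 (fun i => by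
        have h2 : N ∣ -(x i - e i₀ i) := dvd_neg.mpr (hx i)
        rwa [neg_sub] at h2)
    · intro h i
      have h2 := (transl_eq_transl_iff x₀ x (e i₀)).1 h i
      have h3 : N ∣ -(e i₀ i - x i) := dvd_neg.mpr h2
      rwa [neg_sub] at h3
  have hu0 : u x₀ = g := by simp only [hu, if_pos rfl]
  have hu1 : u (x₀.shift i₀) = g⁻¹ := by simp only [hu, if_neg hx₀ne, if_true]
  have huo : ∀ x, x ≠ x₀ → x ≠ x₀.shift i₀ → u x = 1 := fun x h h' => by simp only [hu, if_neg h, if_neg h']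
  have hw0 : ∀ x, (∀ i, N ∣ x i) → w x = expUnit X := by
    intro x hx
    rw [hw, pullGauge_apply, (htr0 x).1 hx, B8Thm2SetupTorus.toUGauge_apply, hu0, hgU]
  have hw1 : ∀ x, (∀ i, N ∣ x i - e i₀ i) → w x = (expUnit X)⁻¹ := by
    intro x hx
    rw [hw, pullGauge_apply, (htr1 x).1 hx, B8Thm2SetupTorus.toUGauge_apply, hu1, map_inv, map_inv, hgU]
  have hw2 : ∀ x, (¬ ∀ i, N ∣ x i) → (¬ ∀ i, N ∣ x i - e i₀ i) → w x = 1 := by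
    intro x hx hx'
    rw [hw, pullGauge_apply, B8Thm2SetupTorus.toUGauge_apply, huo _ (fun h => hx ((htr0 x).2 h)) (fun h => hx' ((htr1 x).2 h)),
      map_one, map_one]
  -- both transformations are restricted relative to the trivial background
  have hbg : pull (unitsField (toUField (1 : GaugeField P 0 (Matrix.specialUnitaryGroup (Fin 2) ℂ)))) x₀ =
      (1 : LSite P.d → Fin P.d → (Matrix (Fin 2) (Fin 2) ℂ)ˣ) := by
    funext z μ
    rw [pull_apply, show unitsField (toUField (1 : GaugeField P 0 (Matrix.specialUnitaryGroup (Fin 2) ℂ))) = fun _ => 1 from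
      unitsField_toUField_one]
    rfl
  have hRu : S.Restricted 1 u := by
    refine hSre 1 u ?_
    rw [hbg, restr129_iff_uavg]
    intro j _ y hy
    obtain rfl : j = k := (mem_torusLam_iff k j y).1 hy
    rw [← hw, uavg_bump_eq_one hL2 hLN hLN' i₀ hXn hw0 hw1 hw2 k hk1]
    rfl
  have hR1 : S.Restricted 1 (fun _ => 1) := by
    refine hSre 1 _ ?_
    rw [hbg, restr129_iff_uavg]
    intro j _ y _
    have : pullGauge (fun x => Unitary.toUnits (toUGauge P 2 (fun _ : Site P 0 => (1 : Matrix.specialUnitaryGroup (Fin 2) ℂ)) x)) x₀ = 1 := by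
      funext z; simp [pullGauge_apply]
    rw [this, B7Eq167Flat.uavg_one_right]
    rfl
  -- the law at `U₀ = U₁ = 1`
  have horb := H 1 1 u (fun _ => 1) hRu hR1
  rw [emb15_one] at horb
  obtain ⟨wg, hwg, heq⟩ := horb
  rw [gaugeAct_gaugeAct] at heq
  have h1 : GaugeField.gaugeAct (fun _ : Site P 0 => (1 : Matrix.specialUnitaryGroup (Fin 2) ℂ))
      (1 : GaugeField P 0 (Matrix.specialUnitaryGroup (Fin 2) ℂ)) = 1 := by
    funext b; simp [GaugeField.gaugeAct]
  have hpure : GaugeField.gaugeAct (fun x => wg x * u x) (fun _ : PBond P 0 => (1 : Matrix.specialUnitaryGroup (Fin 2) ℂ)) = fun _ => 1 := by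
    have : GaugeField.gaugeAct (fun x => wg x * u x) (1 : GaugeField P 0 (Matrix.specialUnitaryGroup (Fin 2) ℂ)) = 1 := by rw [← heq, h1]
    exact this
  -- compare the centres `x₀` and `x₀ + Lᵏe_{i₀}`
  obtain ⟨y₂, hy₂⟩ := transl_embIter_zero_smul hkm (e i₀)
  have hwg0 : wg x₀ = 1 := apply_embIter_eq_one_of_descTransf F hnK.le hwg 0
  have hwg2 : wg (embIter k y₂) = 1 := apply_embIter_eq_one_of_descTransf F hnK.le hwg y₂
  have hNk2 : 2 ≤ P.sitesPerDir k := by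
    show 2 ≤ 2 * P.L ^ (P.m + P.K - k)
    have := Nat.one_le_pow (P.m + P.K - k) P.L (by omega)
    omega
  have hc₂ne0 : embIter k y₂ ≠ x₀ := by
    rw [← hy₂]; intro h
    have h' := ((htr0 _).2 h) i₀
    simp only [Pi.smul_apply, e_apply, if_true, smul_eq_mul, mul_one] at h'
    -- `N = N_k·Lᵏ ∣ Lᵏ` forces `N_k ≤ 1`
    rw [hN, hN0] at h'
    push_cast at h'
    have hLkpos : (0 : ℤ) < (P.L : ℤ) ^ k := by positivity
    have := Int.le_of_dvd hLkpos h'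
    have h2 : (2 : ℤ) * (P.L : ℤ) ^ k ≤ (P.sitesPerDir k : ℤ) * (P.L : ℤ) ^ k := by gcongr; exact_mod_cast hNk2
    linarith
  have hc₂ne1 : embIter k y₂ ≠ x₀.shift i₀ := by
    rw [← hy₂]; intro h
    have h' := ((htr1 _).2 h) i₀
    simp only [Pi.smul_apply, e_apply, if_true, smul_eq_mul, mul_one] at h'
    -- `L ∣ N ∣ Lᵏ − 1` and `L ∣ Lᵏ` force `L ∣ 1`
    have hL1 : (P.L : ℤ) ∣ (P.L : ℤ) ^ k := dvd_pow_self _ (by omega)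
    have : (P.L : ℤ) ∣ 1 := by
      have := dvd_sub hL1 (dvd_trans hLN h')
      simpa using this
    have := Int.le_of_dvd one_pos this
    have : (2 : ℤ) ≤ P.L := by exact_mod_cast hL2
    linarith
  have hu2 : u (embIter k y₂) = 1 := huo _ hc₂ne0 hc₂ne1
  have hcmp := eq_of_gaugeAct_one hpure x₀ (embIter k y₂)
  simp only [hwg0, hwg2, hu0, hu2, one_mul] at hcmp
  -- `g = 1`, i.e. `exp X = 1`, i.e. `X = 0`
  have hexp : exp X = 1 := by
    have := congrArg (fun q : Matrix.specialUnitaryGroup (Fin 2) ℂ => (q : Matrix (Fin 2) (Fin 2) ℂ)) hcmp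
    simpa [hg] using this.symm
  have hX0 : X = 0 := by
    rw [← B7BlockAvgLog.mlog_exp (C := X) (by linarith [Real.log_two_gt_d9]), hexp, mlog_one]
  have : Sm = 0 := by
    have h8 : (((1 : ℝ) / 8 : ℝ) : ℂ) ≠ 0 := by norm_num
    simpa [hX, smul_eq_zero, h8] using hX0
  exact S_ne_zero this

end T3

end Summit.QuantumFields.YangMills.Theorems.Prop7Orbit16Unsat

end
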